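import Summits.AtomisticToContinuum.HydrodynamicLimit.Theorems.OneFlightGossipEngineClampedCurrentsDockEos
import Literature.MathematicalPhysics.KineticTheory.HardSphereEulerProofs
import Literature.MathematicalPhysics.KineticTheory.HardSphereTwoTimePressure
import Literature.Analysis.FunctionSpaces.TorusCalculusProofs
import Literature.Analysis.FluidPDE.FractionalNSPrescribedEnergyIterationLimit
import HarnessLib

/-!
# The heart of Yau's entropy ledger — preliminaries of the assembly (crux `ClampedCurrentsDock`, stmt-14680, line `IdeatorTwoSketch`)

Helper file (`--supports stmt-AtomisticToContinuum-14680`) for the registered stub `stub_oneWindowLedger`: the EOS bridge E8 from the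
landed S4 (`EosConsistency`) to the hypotheses of S8, the parameter clamp to `[0,t]` used to feed globally continuous families to the
local collisional instance, mass conservation and unit admissible mass along a classical solution tied at `t = 0`, and two slab
utilities. prover-line-stmt-AtomisticToContinuum-14680-c2-0 (lead c2).
-/

noncomputable section

namespace Summit.AtomisticToContinuum.HydrodynamicLimit.Theorems.ClampedCurrentsDockHeart

open scoped BigOperators ENNReal Classical Interval Topology
open MeasureTheory Filter Set Topology InformationTheory
open Literature.MathematicalPhysics.KineticTheory Literature.Analysis.FluidPDE Literature.Analysis.FunctionSpaces
open Summit.AtomisticToContinuum.HydrodynamicLimit.Theorems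

/-- **E8 — the EOS bridge from S4 to the hypotheses of S8.** From `EosConsistency` (landed S4) for an insertion factor with the
four defining properties: an analyticity window `η₁ ≤ r`, a real-analytic `F` with `Z(η) = 1 + η F′(η)` on `(0, η₁)` (the
definition of `hsCompressibility` through `hsExcessFreeEnergy`, which agrees with `F` on the open window), positivity of `Rf` and the
logarithmic derivative `(log Rf)′ = 2F′ + ηF″` there. [folklore] -/
theorem eosBridge {r : ℝ} {Rf : ℝ → ℝ} (hr : 0 < r)
    (hsol : ∀ x ∈ Ioo (-r) r, 0 < Rf x ∧ Rf x * (∑' j : ℕ, bE j / (j.factorial : ℝ) * (x * Rf x) ^ j) = 1)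
    (hbd : ∀ x ∈ Icc 0 r, 1 ≤ Rf x ∧ Rf x ≤ 2) (hcont : ContinuousOn Rf (Icc 0 r))
    (huniq : ∀ x ∈ Ioo (-r) r, ∀ R ∈ Icc (1 / 2 : ℝ) 2,
      R * (∑' j : ℕ, bE j / (j.factorial : ℝ) * (x * R) ^ j) = 1 → R = Rf x) :
    ∃ η₁ : ℝ, 0 < η₁ ∧ η₁ ≤ r ∧ ∃ F : ℝ → ℝ, AnalyticOnNhd ℝ F (Ioo (-η₁) η₁) ∧
      (∀ η ∈ Ioo 0 η₁, hsCompressibility η = 1 + η * deriv F η) ∧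
      (∀ η ∈ Ioo 0 η₁, 0 < Rf η ∧ DifferentiableAt ℝ (fun x => Real.log (Rf x)) η ∧
        deriv (fun x => Real.log (Rf x)) η = 2 * deriv F η + η * deriv (deriv F) η) := by
  obtain ⟨η₁, hη₁, hη₁r, F, hF, hEq, hd⟩ := ClampedCurrentsDockEos.stub_eos r Rf hr hsol hbd hcont huniq
  refine ⟨η₁, hη₁, hη₁r, F, hF, fun η hη => ?_, fun η hη => ⟨?_, hd η hη⟩⟩
  · have hev : hsExcessFreeEnergy =ᶠ[𝓝 η] F :=
      (hEq.mono Ioo_subset_Ico_self).eventuallyEq_of_mem (Ioo_mem_nhds hη.1 hη.2)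
    rw [hsCompressibility, hev.deriv_eq]
  · exact (hsol η ⟨by linarith [hη.1], hη.2.trans_le hη₁r⟩).1

/-- The parameter clamp to `[0, t]`. [folklore] -/
def clampTime (t s : ℝ) : ℝ := max 0 (min t s)

/-- The clamp is continuous. [folklore] -/
theorem continuous_clampTime (t : ℝ) : Continuous (clampTime t) :=
  continuous_const.max (continuous_const.min continuous_id)

/-- The clamp lands in `[0, t]` for `0 ≤ t`. [folklore] -/
theorem clampTime_mem {t : ℝ} (ht : 0 ≤ t) (s : ℝ) : clampTime t s ∈ Icc 0 t :=
  ⟨le_max_left _ _, max_le ht (min_le_left _ _)⟩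

/-- The clamp is the identity on `[0, t]`. [folklore] -/
theorem clampTime_of_mem {t s : ℝ} (hs : s ∈ Icc 0 t) : clampTime t s = s := by
  rw [clampTime, min_eq_right hs.2, max_eq_right hs.1]

/-- A family continuous on the slab `[0,t] × 𝕋³`, clamped in the parameter, is globally jointly continuous. [folklore] -/
theorem continuous_uncurry_clamp {Y : Type*} [TopologicalSpace Y] {t : ℝ} (ht : 0 ≤ t) {f : ℝ → T3 → Y}
    (hf : ContinuousOn (Function.uncurry f) (Icc 0 t ×ˢ univ)) :
    Continuous (Function.uncurry fun s x => f (clampTime t s) x) := by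
  have h : Continuous fun p : ℝ × T3 => (clampTime t p.1, p.2) :=
    ((continuous_clampTime t).comp continuous_fst).prodMk continuous_snd
  refine (hf.comp_continuous h fun p => ⟨clampTime_mem ht p.1, mem_univ _⟩)


/-- Joint continuity on a slab of a jointly smooth space–time field. [folklore] -/
theorem continuousOn_uncurry_of_isSmoothSpaceTimeOn {Y : Type*} [NormedAddCommGroup Y] [NormedSpace ℝ Y] {S : Set ℝ}
    {f : ℝ → T3 → Y} (hf : Torus.IsSmoothSpaceTimeOn S f) : ContinuousOn (Function.uncurry f) (S ×ˢ univ) :=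
  Literature.Analysis.FluidPDE.Torus.continuousOn_uncurry_of_continuousOn_stLift hf.continuousOn

/-- Smoothness on a slab is insensitive to the values of the field off the slab. [folklore] -/
theorem isSmoothSpaceTimeOn_congr {Y : Type*} [NormedAddCommGroup Y] [NormedSpace ℝ Y] {S : Set ℝ}
    {f g : ℝ → T3 → Y} (hf : Torus.IsSmoothSpaceTimeOn S f) (hfg : ∀ s ∈ S, g s = f s) :
    Torus.IsSmoothSpaceTimeOn S g := by
  refine (hf : ContDiffOn ℝ _ _ _).congr fun p hp => ?_
  rw [Set.mem_prod] at hp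
  show g p.1 (Torus.proj p.2) = f p.1 (Torus.proj p.2)
  rw [hfg p.1 hp.1]


end Summit.AtomisticToContinuum.HydrodynamicLimit.Theorems.ClampedCurrentsDockHeart

end
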